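import Summits.CriticalPhenomena.CardyFormulaZ2.Theorems.ModulusResponseSmirnovCellAnchorLevelCore
import Literature.Probability.Percolation.TriApproxDomainAssembly

/-!
# Discrete approximations of a conformal rectangle with the cell sandwich (support item `SmirnovCellAnchor`)

Helper file for `Summit.CriticalPhenomena.CardyFormulaZ2.Theses.ModulusResponse.SmirnovCellAnchor`
(stmt-CriticalPhenomena-6471). Copies of the tree's `level_m`, `level_p` (`TriCollarSandwichLevel.lean`)
and `tri_exists_discreteApprox_proof` (`TriApproxDomainAssembly.lean`; Bollobás–Riordan, *Percolation*
(2006), Ch. 7, Lemma 14 p. 184 with (19), Claim 20 p. 192, proof p. 195) in which G02's crossing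
probability `triDomainCrossingProb R δ` is replaced by an abstract quantity `cell δ` whose marked
sandwich inequalities (lower: `P(G crossed) ≤ cell δ + corner terms` for domains straddling arcs
`0, 2`; upper: `cell δ ≤ P(G crossed) + corner terms` for domains straddling arcs `1, 3`, with the
margins of `level_core'`) are taken as hypotheses `hsandL`, `hsandU`. Output: two families of
discrete approximations (`IsDiscreteApprox R G∓`) with `P(G⁻_δ) - o(1) ≤ cell δ ≤ P(G⁺_δ) + o(1)`
(`cell_exists_discreteApprox`).
-/

noncomputable section

open Set Metric Filter Topology MeasureTheory Literature.Probability.LatticeModels Literature.Probability.RandomPlanarGeometry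
  Literature.Probability.Percolation

namespace Summit.CriticalPhenomena.CardyFormulaZ2.Theorems.SmirnovCellAnchor

variable (R : ConformalRectangle) (T : R.toJordanDomain.TubeData)

/-- **Level `ε`, lower half, cell version.** For `R` with boundary of index `1` and `ε > 0`: a width `h ≤ ε` of the
"longer, thinner" collar domain (containing the centre) and `δ₀ > 0` such that for every
`δ < δ₀` the level-`ε` marked inner approximation `G⁻` has arcs mutually within `2ε` of the arcs of
`R`, fills `Φ(B̄(0, 1 - 2ε))`, has face centres `2ε`-dense in `closure Ω`, and
`P(G⁻ has an open crossing from arc 0 to arc 2) ≤ cell δ + ε` (copy of the tree's `level_m`).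
[cite: BollobasRiordan2006, Ch. 7 Lemma 14 (19) p. 184, Claim 20 p. 192] -/
theorem level_m' (hR1 : ∀ z ∈ R.carrier, R.index z = 1) (cell : ℝ → ℝ)
    (hsandL : ∀ ρ > (0 : ℝ), ∃ δ₀ > 0, ∃ t₀ > 0, ∀ δ t : ℝ, 0 < δ → δ < δ₀ → 0 ≤ t → t ≤ t₀ → ∀ {r₁ r₂ : ℝ}, ρ ≤ r₁ →
      ∀ G : TriMarkedDomain 4,
        (∀ x ∈ G.verts, triMeshPoint δ x ∉ R.carrier →
          infDist (triMeshPoint δ x) (R.arc 0) ≤ t ∨ infDist (triMeshPoint δ x) (R.arc 2) ≤ t) →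
        (∀ x ∈ G.verts, triMeshPoint δ x ∈ R.carrier → (∀ i, ρ ≤ dist (triMeshPoint δ x) (R.pt i)) →
          8 * δ < infDist (triMeshPoint δ x) (R.arc 1) ∧ 8 * δ < infDist (triMeshPoint δ x) (R.arc 3)) →
        (∀ u ∈ G.arc 0, (∀ i, ρ ≤ dist (triMeshPoint δ u) (R.pt i)) →
          triMeshPoint δ u ∉ R.carrier ∧ infDist (triMeshPoint δ u) (R.arc 0) ≤ t) →
        (∀ v ∈ G.arc 2, (∀ i, ρ ≤ dist (triMeshPoint δ v) (R.pt i)) →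
          triMeshPoint δ v ∉ R.carrier ∧ infDist (triMeshPoint δ v) (R.arc 2) ≤ t) →
        (∀ u ∈ G.arc 0, r₂ < dist (triMeshPoint δ u) (R.pt 2) ∧ r₂ < dist (triMeshPoint δ u) (R.pt 3)) →
        (∀ v ∈ G.arc 2, r₂ < dist (triMeshPoint δ v) (R.pt 0) ∧ r₂ < dist (triMeshPoint δ v) (R.pt 1)) →
        G.openCrossingProb 0 2 ≤ cell δ +
          ∑ i : Fin 4, (triSitePercolation half).real (triAnnulusCrossing true δ (R.pt i) r₁ r₂)) {ε : ℝ} (hε : 0 < ε) :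
    ∃ (h : ℝ) (hh : 0 < h) (hh1 : h ≤ 1 / 2), h ≤ ε ∧
      T.z₀ ∈ (R.collarRect T (MarkedDomain.abs_le_one_of_sign σm_sign) hh hh1).carrier ∧
      ∃ δ₀ > 0, ∀ δ : ℝ, ∀ hδ : 0 < δ, δ < δ₀ →
        ∃ hc₀ : baseSite T.z₀ δ ∈ innerCoarse (R.collarRect T (MarkedDomain.abs_le_one_of_sign σm_sign) hh hh1).carrier δ,
        ∃ G : TriMarkedDomain 4,
          G.verts = (innerApprox (R.collarRect T (MarkedDomain.abs_le_one_of_sign σm_sign) hh hh1).toJordanDomain hδ hc₀).verts ∧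
          (∀ i : Fin 4, (∀ y ∈ G.arc i, ∃ z ∈ R.arc i, dist (triMeshPoint δ y) z < 2 * ε) ∧
            ∀ z ∈ R.arc i, ∃ y ∈ G.arc i, dist (triMeshPoint δ y) z < 2 * ε) ∧
          (∀ x : Site 2, triMeshPoint δ x ∈ T.Ci.Φ '' closedBall (0 : ℂ) (1 - 2 * ε) → x ∈ G.verts) ∧
          (∀ z ∈ closure R.carrier, ∃ w ∈ G.faces, dist z ((δ : ℂ) * hexCenter w) < 2 * ε) ∧
          G.openCrossingProb 0 2 ≤ cell δ + ε := by
  classical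
  obtain ⟨carc, hcarc0, hcarc⟩ := R.exists_pos_le_infDist_pt_arc
  obtain ⟨α, hα, hbound⟩ := tri_annulusCrossing_bound_holds
  -- work at level `ε' = min ε (carc/4)`
  set ε' := min ε (carc / 4) with hε'
  have hε'0 : 0 < ε' := lt_min hε (by linarith)
  have hε'ε : ε' ≤ ε := min_le_left _ _
  have hε'c : ε' ≤ carc / 4 := min_le_right _ _
  set r₂ := carc / 3 with hr₂
  obtain ⟨ρ, hρ, hρε, hρr, hρα⟩ := exists_corner_radius (r₂ := r₂) hα (by positivity) hε'0
  obtain ⟨δS, hδS, t₀, ht₀, hsand⟩ := hsandL ρ hρ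
  obtain ⟨h, hh, hh1, hhε, hz₀, m, hm, m', hm', δ₀, hδ₀, t, ht0, htt₀, hlev⟩ := level_core' R T σm_sign hR1 hε'0 hρ ht₀ hcarc
  refine ⟨h, hh, hh1, hhε.trans hε'ε, hz₀, min (min δ₀ (min δS (ρ / 1000))) (min (m / 16) (m' / 16)), by positivity, fun δ hδ hδlt => ?_⟩
  have hδ₀' : δ < δ₀ := hδlt.trans_le ((min_le_left _ _).trans (min_le_left _ _))
  have hδS' : δ < δS := hδlt.trans_le ((min_le_left _ _).trans ((min_le_right _ _).trans (min_le_left _ _)))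
  have hδρ : δ < ρ / 1000 := hδlt.trans_le ((min_le_left _ _).trans ((min_le_right _ _).trans (min_le_right _ _)))
  have hδm : δ < m / 16 := hδlt.trans_le ((min_le_right _ _).trans (min_le_left _ _))
  have hδm' : δ < m' / 16 := hδlt.trans_le ((min_le_right _ _).trans (min_le_right _ _))
  obtain ⟨hc₀, G, hGv, harcs, H1, H2, H3, H4, hfill, hdense⟩ := hlev δ hδ hδ₀'
  refine ⟨hc₀, G, hGv, fun i => ⟨fun y hy => ?_, fun z hz => ?_⟩, fun x hx => hfill x ?_, fun z hz => ?_, ?_⟩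
  · obtain ⟨z, hz, hd⟩ := (harcs i).1 y hy; exact ⟨z, hz, by linarith⟩
  · obtain ⟨y, hy, hd⟩ := (harcs i).2 z hz; exact ⟨y, hy, by linarith⟩
  · obtain ⟨u, hu, hux⟩ := hx
    exact ⟨u, closedBall_subset_closedBall (by linarith) hu, hux⟩
  · obtain ⟨w, hw, hd⟩ := hdense z hz; exact ⟨w, hw, by linarith⟩
  -- the sandwich
  have hσ0 : σm 0 = 1 := by simp [σm]
  have hσ2 : σm 2 = 1 := by simp [σm]
  have hσ1' : σm 1 = -1 := by simp [σm]
  have hσ3 : σm 3 = -1 := by simp [σm]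
  have key := hsand δ t hδ hδS' ht0 htt₀ (r₁ := ρ) (r₂ := r₂) le_rfl G
    (fun x hx hxΩ => by
      obtain ⟨i, hi, hd⟩ := H1 x hx hxΩ
      rcases σm_eq_one_iff.1 hi with rfl | rfl
      · exact Or.inl hd
      · exact Or.inr hd)
    (fun x hx hxΩ hfar => ⟨by linarith [H2 x hx hxΩ hfar 1 hσ1'], by linarith [H2 x hx hxΩ hfar 3 hσ3]⟩)
    (fun u hu hfar => ⟨fun huΩ => by
        have h0 : infDist (triMeshPoint δ u) (closure R.carrier) = 0 := infDist_zero_of_mem (subset_closure huΩ)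
        linarith [(H3 0 hσ0 u hu hfar).1], (H3 0 hσ0 u hu hfar).2⟩)
    (fun v hv hfar => ⟨fun hvΩ => by
        have h0 : infDist (triMeshPoint δ v) (closure R.carrier) = 0 := infDist_zero_of_mem (subset_closure hvΩ)
        linarith [(H3 2 hσ2 v hv hfar).1], (H3 2 hσ2 v hv hfar).2⟩)
    (fun u hu => ⟨by linarith [H4 0 u hu 2 (by rw [R.pt_mem_arc_iff]; decide)],
      by linarith [H4 0 u hu 3 (by rw [R.pt_mem_arc_iff]; decide)]⟩)
    (fun v hv => ⟨by linarith [H4 2 v hv 0 (by rw [R.pt_mem_arc_iff]; decide)],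
      by linarith [H4 2 v hv 1 (by rw [R.pt_mem_arc_iff]; decide)]⟩)
  have hcorner : ∀ i : Fin 4, (triSitePercolation half).real (triAnnulusCrossing true δ (R.pt i) ρ r₂) ≤ (ρ / r₂) ^ α :=
    fun i => hbound true δ (R.pt i) ρ r₂ hδ (by linarith) hρr
  have hsum := sum_fin_four_le hcorner
  linarith

/-- **Level `ε`, upper half, cell version.** The same for the "shorter, fatter" collar domain and
`cell δ ≤ P(G⁺ has an open crossing from arc 0 to arc 2) + ε` (copy of the tree's `level_p`).
[cite: BollobasRiordan2006, Ch. 7 Lemma 14 (19) p. 184, Claim 20 p. 192, Lemma 5] -/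
theorem level_p' (hR1 : ∀ z ∈ R.carrier, R.index z = 1) (cell : ℝ → ℝ)
    (hsandU : ∀ ρ > (0 : ℝ), ∃ δ₀ > 0, ∃ t₀ > 0, ∀ δ t : ℝ, 0 < δ → δ < δ₀ → 0 ≤ t → t ≤ t₀ → ∀ {r₁ r₂ : ℝ}, ρ ≤ r₁ →
      ∀ G : TriMarkedDomain 4,
        (∀ x ∈ G.verts, triMeshPoint δ x ∉ R.carrier →
          infDist (triMeshPoint δ x) (R.arc 1) ≤ t ∨ infDist (triMeshPoint δ x) (R.arc 3) ≤ t) →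
        (∀ x ∈ G.verts, triMeshPoint δ x ∈ R.carrier → (∀ i, ρ ≤ dist (triMeshPoint δ x) (R.pt i)) →
          8 * δ < infDist (triMeshPoint δ x) (R.arc 0) ∧ 8 * δ < infDist (triMeshPoint δ x) (R.arc 2)) →
        (∀ u ∈ G.arc 1, (∀ i, ρ ≤ dist (triMeshPoint δ u) (R.pt i)) →
          4 * δ ≤ infDist (triMeshPoint δ u) R.carrier ∧ infDist (triMeshPoint δ u) (R.arc 1) ≤ t) →
        (∀ v ∈ G.arc 3, (∀ i, ρ ≤ dist (triMeshPoint δ v) (R.pt i)) →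
          4 * δ ≤ infDist (triMeshPoint δ v) R.carrier ∧ infDist (triMeshPoint δ v) (R.arc 3) ≤ t) →
        (∀ u ∈ G.arc 1, r₂ < dist (triMeshPoint δ u) (R.pt 3) ∧ r₂ < dist (triMeshPoint δ u) (R.pt 0)) →
        (∀ v ∈ G.arc 3, r₂ < dist (triMeshPoint δ v) (R.pt 1) ∧ r₂ < dist (triMeshPoint δ v) (R.pt 2)) →
        cell δ ≤ G.openCrossingProb 0 2 +
          ∑ i : Fin 4, (triSitePercolation half).real (triAnnulusCrossing false δ (R.pt i) r₁ r₂)) {ε : ℝ} (hε : 0 < ε) :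
    ∃ (h : ℝ) (hh : 0 < h) (hh1 : h ≤ 1 / 2), h ≤ ε ∧
      T.z₀ ∈ (R.collarRect T (MarkedDomain.abs_le_one_of_sign σp_sign) hh hh1).carrier ∧
      ∃ δ₀ > 0, ∀ δ : ℝ, ∀ hδ : 0 < δ, δ < δ₀ →
        ∃ hc₀ : baseSite T.z₀ δ ∈ innerCoarse (R.collarRect T (MarkedDomain.abs_le_one_of_sign σp_sign) hh hh1).carrier δ,
        ∃ G : TriMarkedDomain 4,
          G.verts = (innerApprox (R.collarRect T (MarkedDomain.abs_le_one_of_sign σp_sign) hh hh1).toJordanDomain hδ hc₀).verts ∧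
          (∀ i : Fin 4, (∀ y ∈ G.arc i, ∃ z ∈ R.arc i, dist (triMeshPoint δ y) z < 2 * ε) ∧
            ∀ z ∈ R.arc i, ∃ y ∈ G.arc i, dist (triMeshPoint δ y) z < 2 * ε) ∧
          (∀ x : Site 2, triMeshPoint δ x ∈ T.Ci.Φ '' closedBall (0 : ℂ) (1 - 2 * ε) → x ∈ G.verts) ∧
          (∀ z ∈ closure R.carrier, ∃ w ∈ G.faces, dist z ((δ : ℂ) * hexCenter w) < 2 * ε) ∧
          cell δ ≤ G.openCrossingProb 0 2 + ε := by
  classical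
  obtain ⟨carc, hcarc0, hcarc⟩ := R.exists_pos_le_infDist_pt_arc
  obtain ⟨α, hα, hbound⟩ := tri_annulusCrossing_bound_holds
  set ε' := min ε (carc / 4) with hε'
  have hε'0 : 0 < ε' := lt_min hε (by linarith)
  have hε'ε : ε' ≤ ε := min_le_left _ _
  have hε'c : ε' ≤ carc / 4 := min_le_right _ _
  set r₂ := carc / 3 with hr₂
  obtain ⟨ρ, hρ, hρε, hρr, hρα⟩ := exists_corner_radius (r₂ := r₂) hα (by positivity) hε'0
  obtain ⟨δS, hδS, t₀, ht₀, hsand⟩ := hsandU ρ hρ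
  obtain ⟨h, hh, hh1, hhε, hz₀, m, hm, m', hm', δ₀, hδ₀, t, ht0, htt₀, hlev⟩ := level_core' R T σp_sign hR1 hε'0 hρ ht₀ hcarc
  refine ⟨h, hh, hh1, hhε.trans hε'ε, hz₀, min (min δ₀ (min δS (ρ / 1000))) (min (m / 16) (m' / 16)), by positivity, fun δ hδ hδlt => ?_⟩
  have hδ₀' : δ < δ₀ := hδlt.trans_le ((min_le_left _ _).trans (min_le_left _ _))
  have hδS' : δ < δS := hδlt.trans_le ((min_le_left _ _).trans ((min_le_right _ _).trans (min_le_left _ _)))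
  have hδρ : δ < ρ / 1000 := hδlt.trans_le ((min_le_left _ _).trans ((min_le_right _ _).trans (min_le_right _ _)))
  have hδm : δ < m / 16 := hδlt.trans_le ((min_le_right _ _).trans (min_le_left _ _))
  have hδm' : δ < m' / 16 := hδlt.trans_le ((min_le_right _ _).trans (min_le_right _ _))
  obtain ⟨hc₀, G, hGv, harcs, H1, H2, H3, H4, hfill, hdense⟩ := hlev δ hδ hδ₀'
  refine ⟨hc₀, G, hGv, fun i => ⟨fun y hy => ?_, fun z hz => ?_⟩, fun x hx => hfill x ?_, fun z hz => ?_, ?_⟩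
  · obtain ⟨z, hz, hd⟩ := (harcs i).1 y hy; exact ⟨z, hz, by linarith⟩
  · obtain ⟨y, hy, hd⟩ := (harcs i).2 z hz; exact ⟨y, hy, by linarith⟩
  · obtain ⟨u, hu, hux⟩ := hx
    exact ⟨u, closedBall_subset_closedBall (by linarith) hu, hux⟩
  · obtain ⟨w, hw, hd⟩ := hdense z hz; exact ⟨w, hw, by linarith⟩
  have hσ1 : σp 1 = 1 := by simp [σp]
  have hσ3 : σp 3 = 1 := by simp [σp]
  have hσ0 : σp 0 = -1 := by simp [σp]
  have hσ2 : σp 2 = -1 := by simp [σp]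
  have key := hsand δ t hδ hδS' ht0 htt₀ (r₁ := ρ) (r₂ := r₂) le_rfl G
    (fun x hx hxΩ => by
      obtain ⟨i, hi, hd⟩ := H1 x hx hxΩ
      rcases σp_eq_one_iff.1 hi with rfl | rfl
      · exact Or.inl hd
      · exact Or.inr hd)
    (fun x hx hxΩ hfar => ⟨by linarith [H2 x hx hxΩ hfar 0 hσ0], by linarith [H2 x hx hxΩ hfar 2 hσ2]⟩)
    (fun u hu hfar => ⟨by rw [← infDist_closure]; linarith [(H3 1 hσ1 u hu hfar).1], (H3 1 hσ1 u hu hfar).2⟩)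
    (fun v hv hfar => ⟨by rw [← infDist_closure]; linarith [(H3 3 hσ3 v hv hfar).1], (H3 3 hσ3 v hv hfar).2⟩)
    (fun u hu => ⟨by linarith [H4 1 u hu 3 (by rw [R.pt_mem_arc_iff]; decide)],
      by linarith [H4 1 u hu 0 (by rw [R.pt_mem_arc_iff]; decide)]⟩)
    (fun v hv => ⟨by linarith [H4 3 v hv 1 (by rw [R.pt_mem_arc_iff]; decide)],
      by linarith [H4 3 v hv 2 (by rw [R.pt_mem_arc_iff]; decide)]⟩)
  have hcorner : ∀ i : Fin 4, (triSitePercolation half).real (triAnnulusCrossing false δ (R.pt i) ρ r₂) ≤ (ρ / r₂) ^ α :=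
    fun i => hbound false δ (R.pt i) ρ r₂ hδ (by linarith) hρr
  have hsum := sum_fin_four_le hcorner
  linarith

/-- **Discrete approximations with the cell sandwich** (copy of the tree's
`tri_exists_discreteApprox_proof`, Bollobás–Riordan 2006, Ch. 7, Lemma 14 p. 184, proof p. 195, with
`triDomainCrossingProb R δ` replaced by an abstract quantity `cell δ` satisfying the two marked
sandwich inequalities `hsandL`, `hsandU`): for a conformal rectangle `R` with boundary of index `1`
there are discrete approximations `G⁻_δ`, `G⁺_δ` of `R` (`IsDiscreteApprox`) with
`P(G⁻_δ crossed) - o(1) ≤ cell δ ≤ P(G⁺_δ crossed) + o(1)`.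
[cite: BollobasRiordan2006, Ch. 7 Lemma 14 p. 184, proof p. 195] -/
theorem cell_exists_discreteApprox (hR1 : ∀ z ∈ R.carrier, R.index z = 1) (cell : ℝ → ℝ)
    (hsandL : ∀ ρ > (0 : ℝ), ∃ δ₀ > 0, ∃ t₀ > 0, ∀ δ t : ℝ, 0 < δ → δ < δ₀ → 0 ≤ t → t ≤ t₀ → ∀ {r₁ r₂ : ℝ}, ρ ≤ r₁ →
      ∀ G : TriMarkedDomain 4,
        (∀ x ∈ G.verts, triMeshPoint δ x ∉ R.carrier →
          infDist (triMeshPoint δ x) (R.arc 0) ≤ t ∨ infDist (triMeshPoint δ x) (R.arc 2) ≤ t) →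
        (∀ x ∈ G.verts, triMeshPoint δ x ∈ R.carrier → (∀ i, ρ ≤ dist (triMeshPoint δ x) (R.pt i)) →
          8 * δ < infDist (triMeshPoint δ x) (R.arc 1) ∧ 8 * δ < infDist (triMeshPoint δ x) (R.arc 3)) →
        (∀ u ∈ G.arc 0, (∀ i, ρ ≤ dist (triMeshPoint δ u) (R.pt i)) →
          triMeshPoint δ u ∉ R.carrier ∧ infDist (triMeshPoint δ u) (R.arc 0) ≤ t) →
        (∀ v ∈ G.arc 2, (∀ i, ρ ≤ dist (triMeshPoint δ v) (R.pt i)) →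
          triMeshPoint δ v ∉ R.carrier ∧ infDist (triMeshPoint δ v) (R.arc 2) ≤ t) →
        (∀ u ∈ G.arc 0, r₂ < dist (triMeshPoint δ u) (R.pt 2) ∧ r₂ < dist (triMeshPoint δ u) (R.pt 3)) →
        (∀ v ∈ G.arc 2, r₂ < dist (triMeshPoint δ v) (R.pt 0) ∧ r₂ < dist (triMeshPoint δ v) (R.pt 1)) →
        G.openCrossingProb 0 2 ≤ cell δ +
          ∑ i : Fin 4, (triSitePercolation half).real (triAnnulusCrossing true δ (R.pt i) r₁ r₂))
    (hsandU : ∀ ρ > (0 : ℝ), ∃ δ₀ > 0, ∃ t₀ > 0, ∀ δ t : ℝ, 0 < δ → δ < δ₀ → 0 ≤ t → t ≤ t₀ → ∀ {r₁ r₂ : ℝ}, ρ ≤ r₁ →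
      ∀ G : TriMarkedDomain 4,
        (∀ x ∈ G.verts, triMeshPoint δ x ∉ R.carrier →
          infDist (triMeshPoint δ x) (R.arc 1) ≤ t ∨ infDist (triMeshPoint δ x) (R.arc 3) ≤ t) →
        (∀ x ∈ G.verts, triMeshPoint δ x ∈ R.carrier → (∀ i, ρ ≤ dist (triMeshPoint δ x) (R.pt i)) →
          8 * δ < infDist (triMeshPoint δ x) (R.arc 0) ∧ 8 * δ < infDist (triMeshPoint δ x) (R.arc 2)) →
        (∀ u ∈ G.arc 1, (∀ i, ρ ≤ dist (triMeshPoint δ u) (R.pt i)) →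
          4 * δ ≤ infDist (triMeshPoint δ u) R.carrier ∧ infDist (triMeshPoint δ u) (R.arc 1) ≤ t) →
        (∀ v ∈ G.arc 3, (∀ i, ρ ≤ dist (triMeshPoint δ v) (R.pt i)) →
          4 * δ ≤ infDist (triMeshPoint δ v) R.carrier ∧ infDist (triMeshPoint δ v) (R.arc 3) ≤ t) →
        (∀ u ∈ G.arc 1, r₂ < dist (triMeshPoint δ u) (R.pt 3) ∧ r₂ < dist (triMeshPoint δ u) (R.pt 0)) →
        (∀ v ∈ G.arc 3, r₂ < dist (triMeshPoint δ v) (R.pt 1) ∧ r₂ < dist (triMeshPoint δ v) (R.pt 2)) →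
        cell δ ≤ G.openCrossingProb 0 2 +
          ∑ i : Fin 4, (triSitePercolation half).real (triAnnulusCrossing false δ (R.pt i) r₁ r₂)) :
    ∃ Gm Gp : ℝ → TriMarkedDomain 4, IsDiscreteApprox R Gm ∧ IsDiscreteApprox R Gp ∧
      ∃ e : ℝ → ℝ, Tendsto e (𝓝[>] 0) (𝓝 0) ∧ ∀ᶠ δ in 𝓝[>] (0 : ℝ),
        (Gm δ).openCrossingProb 0 2 - e δ ≤ cell δ ∧ cell δ ≤ (Gp δ).openCrossingProb 0 2 + e δ := by
  classical
  obtain ⟨T⟩ := R.toJordanDomain.nonempty_tubeData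
  -- local connectivity data at the scales `γ_k = 1/(k+1)` (Claim 21, uniform in the level)
  have hc : ∀ γ > (0 : ℝ), ∃ η > (0 : ℝ), ∃ ε₁ > (0 : ℝ), ∀ (σ : Fin 4 → ℝ) (hσ1 : ∀ i, σ i = 1 ∨ σ i = -1) (h : ℝ) (hh : 0 < h)
      (hh1 : h ≤ 1 / 2), h ≤ ε₁ → T.z₀ ∈ (R.collarRect T (MarkedDomain.abs_le_one_of_sign hσ1) hh hh1).carrier →
      ∃ δ₁ > (0 : ℝ), ∀ (δ : ℝ) (hδ : 0 < δ)
        (hc₀ : baseSite T.z₀ δ ∈ innerCoarse (R.collarRect T (MarkedDomain.abs_le_one_of_sign hσ1) hh hh1).carrier δ), δ < δ₁ →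
        (∀ x ∈ (innerApprox (R.collarRect T (MarkedDomain.abs_le_one_of_sign hσ1) hh hh1).toJordanDomain hδ hc₀).verts,
          ∀ y ∈ (innerApprox (R.collarRect T (MarkedDomain.abs_le_one_of_sign hσ1) hh hh1).toJordanDomain hδ hc₀).verts,
            dist (triMeshPoint δ x) (triMeshPoint δ y) < η →
            PathIn triGraph (((innerApprox (R.collarRect T (MarkedDomain.abs_le_one_of_sign hσ1) hh hh1).toJordanDomain hδ hc₀).verts :
              Set (Site 2)) ∩ {v | dist (triMeshPoint δ x) (triMeshPoint δ v) < γ}) x y) ∧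
        (∀ w ∈ triFacesIn (innerApprox (R.collarRect T (MarkedDomain.abs_le_one_of_sign hσ1) hh hh1).toJordanDomain hδ hc₀).verts,
          ∀ z ∈ triFacesIn (innerApprox (R.collarRect T (MarkedDomain.abs_le_one_of_sign hσ1) hh hh1).toJordanDomain hδ hc₀).verts,
            dist ((δ : ℂ) * hexCenter w) ((δ : ℂ) * hexCenter z) < η →
            Relation.ReflTransGen (fun F F' : HexVertex => hexGraph.Adj F F' ∧
              F' ∈ triFacesIn (innerApprox (R.collarRect T (MarkedDomain.abs_le_one_of_sign hσ1) hh hh1).toJordanDomain hδ hc₀).verts ∧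
              dist ((δ : ℂ) * hexCenter w) ((δ : ℂ) * hexCenter F') < 2 * γ) w z) := by
    intro γ hγ
    obtain ⟨ηs, hηs, hsite⟩ := site_conn_collar R T hγ
    obtain ⟨ηf, hηf, hface⟩ := face_conn_collar R T hγ
    refine ⟨min ηs ηf, lt_min hηs hηf, 1, one_pos, fun σ hσ1 h hh hh1 _ _ => ⟨min ηs ηf, lt_min hηs hηf, fun δ hδ hc₀ hδlt => ⟨?_, ?_⟩⟩⟩
    · intro x hx y hy hxy
      exact hsite σ _ h hh hh1 δ hδ hc₀ (hδlt.trans_le (min_le_left _ _)) x hx y hy (hxy.trans_le (min_le_left _ _))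
    · intro w hw z hz hwz
      exact hface σ _ h hh hh1 δ hδ hc₀ (hδlt.trans_le (min_le_right _ _)) w hw z hz (hwz.trans_le (min_le_right _ _))
  choose η hη ε₁ hε₁ hck using fun k : ℕ => hc (1 / ((k : ℝ) + 1)) (by positivity)
  set θ : ℕ → ℝ := fun k => min (ε₁ k) (1 / ((k : ℝ) + 1)) with hθ
  have hθ0 : ∀ k, 0 < θ k := fun k => lt_min (hε₁ k) (by positivity)
  -- the per-level predicate (the tree's `LevelProp`, unfolded)
  set LP : ℝ → ℝ → TriMarkedDomain 4 → Prop := fun ε δ G =>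
    (∀ i : Fin 4, (∀ y ∈ G.arc i, ∃ z ∈ R.arc i, dist (triMeshPoint δ y) z < 2 * ε) ∧
      ∀ z ∈ R.arc i, ∃ y ∈ G.arc i, dist (triMeshPoint δ y) z < 2 * ε) ∧
    (∀ x : Site 2, triMeshPoint δ x ∈ T.Ci.Φ '' closedBall (0 : ℂ) (1 - 2 * ε) → x ∈ G.verts) ∧
    (∀ z ∈ closure R.carrier, ∃ w ∈ G.faces, dist z ((δ : ℂ) * hexCenter w) < 2 * ε) ∧
    (∀ k : ℕ, ε ≤ θ k →
      (∀ x ∈ G.verts, ∀ y ∈ G.verts, dist (triMeshPoint δ x) (triMeshPoint δ y) < η k →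
        PathIn triGraph ((G.verts : Set (Site 2)) ∩ {v | dist (triMeshPoint δ x) (triMeshPoint δ v) < 1 / ((k : ℝ) + 1)}) x y) ∧
      (∀ w ∈ G.faces, ∀ z ∈ G.faces, dist ((δ : ℂ) * hexCenter w) ((δ : ℂ) * hexCenter z) < η k →
        Relation.ReflTransGen (fun F F' : HexVertex => hexGraph.Adj F F' ∧ F' ∈ G.faces ∧
          dist ((δ : ℂ) * hexCenter w) ((δ : ℂ) * hexCenter F') < 2 * (1 / ((k : ℝ) + 1))) w z)) with hLP
  set P : ℝ → ℝ → Prop := fun ε δ => ∃ Gm Gp : TriMarkedDomain 4,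
    (LP ε δ Gm ∧ Gm.openCrossingProb 0 2 ≤ cell δ + ε) ∧
    (LP ε δ Gp ∧ cell δ ≤ Gp.openCrossingProb 0 2 + ε) with hP
  have hPall : ∀ ε > 0, ∃ δ₀ > 0, ∀ δ, 0 < δ → δ < δ₀ → P ε δ := by
    intro ε hε
    obtain ⟨hm, hhm, hhm1, hmε, hz₀m, δm, hδm, hlevm⟩ := level_m' R T hR1 cell hsandL hε
    obtain ⟨hp, hhp, hhp1, hpε, hz₀p, δp, hδp, hlevp⟩ := level_p' R T hR1 cell hsandU hε
    -- connectivity thresholds for the finitely many relevant `k`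
    have hkN : ∀ k : ℕ, ε ≤ θ k → k < ⌈1 / ε⌉₊ + 1 := by
      intro k hk
      have h1 : ε ≤ 1 / ((k : ℝ) + 1) := hk.trans (min_le_right _ _)
      have h2 : (k : ℝ) + 1 ≤ 1 / ε := by
        rw [le_div_iff₀ hε]; rw [le_div_iff₀ (by positivity)] at h1; linarith
      have h3 : (k : ℝ) < ⌈1 / ε⌉₊ + 1 := by linarith [Nat.le_ceil (1 / ε)]
      exact_mod_cast h3
    have hdm : ∀ k, ∃ d > (0 : ℝ), ε ≤ θ k → ∀ (δ : ℝ) (hδ : 0 < δ)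
        (hc₀ : baseSite T.z₀ δ ∈ innerCoarse (R.collarRect T (MarkedDomain.abs_le_one_of_sign σm_sign) hhm hhm1).carrier δ), δ < d → _ :=
      fun k => by
        by_cases hk : ε ≤ θ k
        · obtain ⟨δ₁, hδ₁, h⟩ := hck k σm σm_sign hm hhm hhm1 (hmε.trans (hk.trans (min_le_left _ _))) hz₀m
          exact ⟨δ₁, hδ₁, fun _ => h⟩
        · exact ⟨1, one_pos, fun h => absurd h hk⟩
    choose dm hdm0 hdmk using hdm
    have hdp : ∀ k, ∃ d > (0 : ℝ), ε ≤ θ k → ∀ (δ : ℝ) (hδ : 0 < δ)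
        (hc₀ : baseSite T.z₀ δ ∈ innerCoarse (R.collarRect T (MarkedDomain.abs_le_one_of_sign σp_sign) hhp hhp1).carrier δ), δ < d → _ :=
      fun k => by
        by_cases hk : ε ≤ θ k
        · obtain ⟨δ₁, hδ₁, h⟩ := hck k σp σp_sign hp hhp hhp1 (hpε.trans (hk.trans (min_le_left _ _))) hz₀p
          exact ⟨δ₁, hδ₁, fun _ => h⟩
        · exact ⟨1, one_pos, fun h => absurd h hk⟩
    choose dp hdp0 hdpk using hdp
    obtain ⟨Dm, hDm, hDmk⟩ := exists_pos_le_forall_lt hdm0 (⌈1 / ε⌉₊ + 1)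
    obtain ⟨Dp, hDp, hDpk⟩ := exists_pos_le_forall_lt hdp0 (⌈1 / ε⌉₊ + 1)
    refine ⟨min (min δm δp) (min Dm Dp), by positivity, fun δ hδ hδlt => ?_⟩
    have hδm' : δ < δm := hδlt.trans_le ((min_le_left _ _).trans (min_le_left _ _))
    have hδp' : δ < δp := hδlt.trans_le ((min_le_left _ _).trans (min_le_right _ _))
    have hδDm : δ < Dm := hδlt.trans_le ((min_le_right _ _).trans (min_le_left _ _))
    have hδDp : δ < Dp := hδlt.trans_le ((min_le_right _ _).trans (min_le_right _ _))
    obtain ⟨hc₀m, Gm, hGmv, harcm, hfillm, hdensem, hsandm⟩ := hlevm δ hδ hδm'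
    obtain ⟨hc₀p, Gp, hGpv, harcp, hfillp, hdensep, hsandp⟩ := hlevp δ hδ hδp'
    refine ⟨Gm, Gp, ⟨⟨harcm, hfillm, hdensem, fun k hk => ?_⟩, hsandm⟩, ⟨⟨harcp, hfillp, hdensep, fun k hk => ?_⟩, hsandp⟩⟩
    · have := hdmk k hk δ hδ hc₀m ((hδDm.trans_le (hDmk k (hkN k hk))))
      rw [← hGmv] at this
      exact this
    · have := hdpk k hk δ hδ hc₀p ((hδDp.trans_le (hDpk k (hkN k hk))))
      rw [← hGpv] at this
      exact this
  obtain ⟨e, he, hepos, heP⟩ := exists_scale_tendsto hPall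
  -- the families
  obtain ⟨δs, hδs⟩ := heP.exists
  set G₀ : TriMarkedDomain 4 := hδs.choose with hG₀
  set Gm : ℝ → TriMarkedDomain 4 := fun δ => if hPδ : P (e δ) δ then hPδ.choose else G₀ with hGm
  set Gp : ℝ → TriMarkedDomain 4 := fun δ => if hPδ : P (e δ) δ then hPδ.choose_spec.choose else G₀ with hGp
  have hspec : ∀ δ, P (e δ) δ →
      (LP (e δ) δ (Gm δ) ∧ (Gm δ).openCrossingProb 0 2 ≤ cell δ + e δ) ∧
      (LP (e δ) δ (Gp δ) ∧ cell δ ≤ (Gp δ).openCrossingProb 0 2 + e δ) := by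
    intro δ hPδ
    have h1 : Gm δ = hPδ.choose := by simp only [hGm, dif_pos hPδ]
    have h2 : Gp δ = hPδ.choose_spec.choose := by simp only [hGp, dif_pos hPδ]
    rw [h1, h2]
    exact hPδ.choose_spec.choose_spec
  have he2 : Tendsto (fun δ => 2 * e δ) (𝓝[>] 0) (𝓝 0) := by simpa using he.const_mul 2
  -- eventual smallness of `e`
  have hsmall : ∀ c > 0, ∀ᶠ δ in 𝓝[>] (0 : ℝ), e δ < c := fun c hc => he (Iio_mem_nhds hc)
  -- the common `IsDiscreteApprox` verification
  have happrox : ∀ (G : ℝ → TriMarkedDomain 4), (∀ᶠ δ in 𝓝[>] (0 : ℝ), LP (e δ) δ (G δ)) → IsDiscreteApprox R G := by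
    intro G hG
    refine ⟨⟨fun δ => 2 * e δ, he2, hG.mono fun δ hδ i => ⟨fun z hz => ?_, fun y hy => ?_⟩⟩,
      ⟨fun δ => 2 * e δ, he2, hG.mono fun δ hδ z hz => ?_⟩, fun K hK hKΩ => ?_, fun γ hγ => ?_, fun γ hγ => ?_⟩
    · obtain ⟨y, hy, hd⟩ := (hδ.1 i).2 z hz
      exact ⟨_, ⟨y, hy, rfl⟩, by rw [dist_comm]; exact hd.le⟩
    · obtain ⟨y', hy', rfl⟩ := hy
      obtain ⟨z, hz, hd⟩ := (hδ.1 i).1 y' hy'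
      exact ⟨z, hz, hd.le⟩
    · obtain ⟨w, hw, hd⟩ := hδ.2.2.1 z hz
      exact ⟨w, hw, hd.le⟩
    · -- fill: `K ⊆ Φ(B̄(0, r))` for some `r < 1`
      have hKc : IsCompact (T.Ci.φ.symm '' K) := hK.image_of_continuousOn (T.Ci.φ.symm.continuousOn.mono hKΩ)
      have hKball : T.Ci.φ.symm '' K ⊆ ball (0 : ℂ) 1 := by
        rintro _ ⟨x, hx, rfl⟩
        have := T.Ci.φ.symm.toPartialEquiv.map_source (x := x) (by rw [T.Ci.φ.symm.source_eq]; exact hKΩ hx)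
        rwa [T.Ci.φ.symm.target_eq] at this
      obtain ⟨r, hr1, hKr⟩ : ∃ r < 1, ∀ u ∈ T.Ci.φ.symm '' K, ‖u‖ ≤ r := by
        rcases (T.Ci.φ.symm '' K).eq_empty_or_nonempty with h0 | hne
        · exact ⟨0, one_pos, by rw [h0]; simp⟩
        · obtain ⟨u₀, hu₀, hmax⟩ := hKc.exists_isMaxOn hne continuous_norm.continuousOn
          exact ⟨‖u₀‖, mem_ball_zero_iff.1 (hKball hu₀), fun u hu => hmax hu⟩
      filter_upwards [hG, hsmall ((1 - r) / 2) (by linarith)] with δ hδ hδs x hx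
      refine hδ.2.1 x ⟨T.Ci.φ.symm (triMeshPoint δ x), mem_closedBall_zero_iff.2 ?_, ?_⟩
      · linarith [hKr _ ⟨_, hx, rfl⟩]
      · have hxΩ := hKΩ hx
        rw [T.Ci.eqOn (hKball ⟨_, hx, rfl⟩)]
        exact T.Ci.φ.apply_symm_apply hxΩ
    · -- site connectivity
      obtain ⟨k, hk⟩ := exists_nat_one_div_lt hγ
      refine ⟨η k, hη k, ?_⟩
      filter_upwards [hG, hsmall (θ k) (hθ0 k)] with δ hδ hδs x hx y hy hxy
      exact (hδ.2.2.2 k hδs.le).1 x hx y hy hxy |>.mono (inter_subset_inter_right _ fun v (hv : _ < _) => hv.trans hk)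
    · -- local connectivity of faces
      obtain ⟨k, hk⟩ := exists_nat_one_div_lt hγ
      refine ⟨η k, hη k, ?_⟩
      filter_upwards [hG, hsmall (θ k) (hθ0 k)] with δ hδ hδs w hw z hz hwz
      have hpath := (hδ.2.2.2 k hδs.le).2 w hw z hz hwz
      have hp : (fun F F' : HexVertex => hexGraph.Adj F F' ∧ F' ∈ (G δ).faces ∧
          dist ((δ : ℂ) * hexCenter w) ((δ : ℂ) * hexCenter F') < 2 * (1 / ((k : ℝ) + 1))) ≤
          (fun F F' : HexVertex => hexGraph.Adj F F' ∧ F' ∈ (G δ).faces ∧ dist ((δ : ℂ) * hexCenter w) ((δ : ℂ) * hexCenter F') < 2 * γ) :=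
        fun F F' hFF' => ⟨hFF'.1, hFF'.2.1, by linarith [hFF'.2.2]⟩
      exact Relation.ReflTransGen.mono hp w z hpath
  refine ⟨Gm, Gp, happrox Gm (heP.mono fun δ hδ => (hspec δ hδ).1.1), happrox Gp (heP.mono fun δ hδ => (hspec δ hδ).2.1),
    e, he, heP.mono fun δ hδ => ⟨?_, ?_⟩⟩
  · linarith [(hspec δ hδ).1.2]
  · linarith [(hspec δ hδ).2.2]


end Summit.CriticalPhenomena.CardyFormulaZ2.Theorems.SmirnovCellAnchor

end
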